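import Mathlib
import Summits.ValiantsHypothesis.ValiantsHypothesis.Theorems.BarrierLeverPartitionMinorsHitByVPHiddenStatesTranslatedMoebius

/-!
# Route BarrierLever — item `PartitionMinorsHitByVP` (stmt-ValiantsHypothesis-19717), line `hidden-states`:
# BALL-DIAGONAL IV — the block structure over `2^C` and the lower blocks (PROOF-balldiagonal §1, first half of §2)

Helper file (`--supports stmt-ValiantsHypothesis-19717`; cell valiant-natproofs, rung V4, 𝒟-side door (c), registered line
`Cruxes/PartitionMinorsHitByVP/Lines/hidden_states.lean` v8; prover seat val-np-p6 gen 13). Definition-free; closes NO item.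

SETTING (HOME/val-np-p6/g12/PROOF-balldiagonal-p6g12.md). Coordinates `Fin h` split into a CORE `C` and the non-core block `N = univ ∖ C`;
faces `F c` (`c ∈ C`); the σ-table entry of the ball column `J` against the row `S` is (p630805 `Tilt.exists_sigmaTable`)
`[S ∩ C ⊆ J] · ∏_{a ∈ S ∖ C} ([a ∈ J] − #{c ∈ J ∩ C : a ∈ F c})`. A ROW-KERNEL vector is a function `b` on the subsets of `Fin h` with
`Σ_S b S · entry(J, S) = 0` for every column `|J| ≤ h − 2` (hypothesis `hcol`; in the application `b` is supported on the down-set).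

* `block_column_eq` — THE BLOCK FORM of the column equation at `J = D ⊔ I` (`D ⊆ C`, `I ⊆ N`): writing rows as `S = D₀ ⊔ T`,
  `Σ_{D₀ ⊆ D} Σ_{T ⊆ N} b(D₀ ⊔ T) · ∏_{a ∈ T} ([a ∈ I] − Λ_D(a)) = 0`, `Λ_D(a) = #{c ∈ D : a ∈ F c}` (PROOF §1: `x^S(v_J) = [D₀ ⊆ D]·Z_{Λ(D)}[T, I]`).
* `lowerBlocks_zero` — STEP A: `b(D ⊔ T) = 0` whenever `|D| ≤ |C| − 2` (induction up `D`; each step is a translated Möbius inversion on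
  all of `2^N`, file …TranslatedMoebius).
* `eraseBlock_eq` — STEP B(i): for `q ∈ C`, `b((C∖q) ⊔ T) = κ_q · ∏_{a ∈ N∖T} μ_q(a)` with `κ_q = b(univ∖q)` and `μ_q = Λ_{C∖q}`
  (the evaluations of `g_q` vanish at every `I ≠ N`, so only the top translate survives).

WHAT THIS IS NOT: half of the elimination; the top block (STEP B(ii)), the face-poset system and the cells are in the sequel files;
nothing on crux 14610 or VP ≠ VNP.
-/

set_option linter.dupNamespace false

namespace Summit.ValiantsHypothesis.ValiantsHypothesis.Theorems.BarrierLever.HiddenStates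

open Finset

noncomputable section

namespace BallDiag

/-- **THE BLOCK FORM OF A COLUMN EQUATION** (PROOF §1). See the module docstring. -/
theorem block_column_eq (h : ℕ) (C N : Finset (Fin h)) (hN : N = Finset.univ \ C) (F : Fin h → Finset (Fin h))
    (b : Finset (Fin h) → ℂ)
    (hcol : ∀ J : Finset (Fin h), J.card + 2 ≤ h →
      ∑ S : Finset (Fin h), b S * ((if S ∩ C ⊆ J then 1 else 0) *
        ∏ a ∈ S \ C, ((if a ∈ J then (1 : ℂ) else 0) - (((J ∩ C).filter fun c => a ∈ F c).card : ℂ))) = 0)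
    (D I : Finset (Fin h)) (hD : D ⊆ C) (hI : I ⊆ N) (hcard : D.card + I.card + 2 ≤ h) :
    ∑ D₀ ∈ C.powerset with D₀ ⊆ D, ∑ T ∈ N.powerset,
      b (D₀ ∪ T) * ∏ a ∈ T, ((if a ∈ I then (1 : ℂ) else 0) - ((D.filter fun c => a ∈ F c).card : ℂ)) = 0 := by
  have hmemN : ∀ x, x ∈ N ↔ x ∉ C := fun x => by simp [hN]
  have hdisj : Disjoint D I := by
    rw [Finset.disjoint_left]
    intro x hxD hxI
    exact (hmemN x).mp (hI hxI) (hD hxD)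
  have hJ : (D ∪ I).card + 2 ≤ h := by rw [Finset.card_union_of_disjoint hdisj]; exact hcard
  have h1 := hcol (D ∪ I) hJ
  rw [sum_univ_eq_sum_union C, ← hN] at h1
  rw [Finset.sum_filter]
  refine Eq.trans ?_ h1
  refine Finset.sum_congr rfl fun D₀ hD₀ => ?_
  have hD₀C : D₀ ⊆ C := Finset.mem_powerset.mp hD₀
  have hDIC : (D ∪ I) ∩ C = D := by
    ext x
    simp only [Finset.mem_inter, Finset.mem_union]
    constructor
    · rintro ⟨hx | hx, hxC⟩
      · exact hx
      · exact absurd hxC ((hmemN x).mp (hI hx))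
    · intro hx
      exact ⟨Or.inl hx, hD hx⟩
  -- the entry against the row `D₀ ⊔ T`
  have hent : ∀ T ∈ N.powerset,
      (if (D₀ ∪ T) ∩ C ⊆ D ∪ I then (1 : ℂ) else 0) *
        ∏ a ∈ (D₀ ∪ T) \ C, ((if a ∈ D ∪ I then (1 : ℂ) else 0) - ((((D ∪ I) ∩ C).filter fun c => a ∈ F c).card : ℂ))
      = (if D₀ ⊆ D then (1 : ℂ) else 0) *
        ∏ a ∈ T, ((if a ∈ I then (1 : ℂ) else 0) - ((D.filter fun c => a ∈ F c).card : ℂ)) := by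
    intro T hT
    have hTN : T ⊆ N := Finset.mem_powerset.mp hT
    have hcapC : (D₀ ∪ T) ∩ C = D₀ := by
      ext x
      simp only [Finset.mem_inter, Finset.mem_union]
      constructor
      · rintro ⟨hx | hx, hxC⟩
        · exact hx
        · exact absurd hxC ((hmemN x).mp (hTN hx))
      · intro hx
        exact ⟨Or.inl hx, hD₀C hx⟩
    have hsubiff : D₀ ⊆ D ∪ I ↔ D₀ ⊆ D := by
      constructor
      · intro hsub x hx
        rcases Finset.mem_union.mp (hsub hx) with h' | h'
        · exact h'
        · exact absurd (hD₀C hx) ((hmemN x).mp (hI h'))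
      · intro hsub x hx
        exact Finset.mem_union.mpr (Or.inl (hsub hx))
    have hsdC : (D₀ ∪ T) \ C = T := by
      ext x
      simp only [Finset.mem_sdiff, Finset.mem_union]
      constructor
      · rintro ⟨hx | hx, hxC⟩
        · exact absurd (hD₀C hx) hxC
        · exact hx
      · intro hx
        exact ⟨Or.inr hx, (hmemN x).mp (hTN hx)⟩
    rw [hcapC, hsdC, hDIC]
    have hfac : ∀ a ∈ T, ((if a ∈ D ∪ I then (1 : ℂ) else 0) - ((D.filter fun c => a ∈ F c).card : ℂ))
        = ((if a ∈ I then (1 : ℂ) else 0) - ((D.filter fun c => a ∈ F c).card : ℂ)) := by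
      intro a ha
      have : a ∈ D ∪ I ↔ a ∈ I := by
        rw [Finset.mem_union]
        constructor
        · rintro (h' | h')
          · exact absurd (hD h') ((hmemN a).mp (hTN ha))
          · exact h'
        · exact Or.inr
      simp only [this]
    rw [Finset.prod_congr rfl hfac]
    by_cases hsub : D₀ ⊆ D
    · rw [if_pos hsub, if_pos (hsubiff.mpr hsub)]
    · rw [if_neg hsub, if_neg (fun h' => hsub (hsubiff.mp h'))]
  by_cases hsub : D₀ ⊆ D
  · rw [if_pos hsub]
    refine Finset.sum_congr rfl fun T hT => ?_
    rw [hent T hT, if_pos hsub, one_mul]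
  · rw [if_neg hsub]
    symm
    refine Finset.sum_eq_zero fun T hT => ?_
    rw [hent T hT, if_neg hsub, zero_mul, mul_zero]

/-- **STEP A — THE LOWER BLOCKS VANISH.** See the module docstring. -/
theorem lowerBlocks_zero (h : ℕ) (C N : Finset (Fin h)) (hN : N = Finset.univ \ C) (F : Fin h → Finset (Fin h))
    (b : Finset (Fin h) → ℂ)
    (hcol : ∀ J : Finset (Fin h), J.card + 2 ≤ h →
      ∑ S : Finset (Fin h), b S * ((if S ∩ C ⊆ J then 1 else 0) *
        ∏ a ∈ S \ C, ((if a ∈ J then (1 : ℂ) else 0) - (((J ∩ C).filter fun c => a ∈ F c).card : ℂ))) = 0) :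
    ∀ D ∈ C.powerset, D.card + 2 ≤ C.card → ∀ T ∈ N.powerset, b (D ∪ T) = 0 := by
  have hsn : C.card + N.card = h := by
    rw [hN, Finset.card_sdiff_of_subset (Finset.subset_univ C), Finset.card_univ, Fintype.card_fin]
    have : C.card ≤ h := by simpa using Finset.card_le_univ C
    omega
  intro D
  induction D using Finset.strongInduction with
  | H D ih =>
    intro hDC hDcard T hT
    have hD : D ⊆ C := Finset.mem_powerset.mp hDC
    -- the translated evaluations of `T ↦ b (D ⊔ T)` vanish at every `I ⊆ N`
    have hg : ∀ I ∈ N.powerset, ∑ T ∈ N.powerset,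
        (fun T => b (D ∪ T)) T * ∏ a ∈ T, ((if a ∈ I then (1 : ℂ) else 0)
          - (fun a => ((D.filter fun c => a ∈ F c).card : ℂ)) a) = 0 := by
      intro I hI
      have hI' : I ⊆ N := Finset.mem_powerset.mp hI
      have hcard : D.card + I.card + 2 ≤ h := by
        have := Finset.card_le_card hI'
        omega
      have h1 := block_column_eq h C N hN F b hcol D I hD hI' hcard
      have hDmem : D ∈ C.powerset.filter (fun D₀ => D₀ ⊆ D) := Finset.mem_filter.mpr ⟨hDC, subset_refl D⟩
      rw [← Finset.add_sum_erase _ _ hDmem] at h1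
      have hrest : ∑ D₀ ∈ (C.powerset.filter (fun D₀ => D₀ ⊆ D)).erase D, ∑ T ∈ N.powerset,
          b (D₀ ∪ T) * ∏ a ∈ T, ((if a ∈ I then (1 : ℂ) else 0) - ((D.filter fun c => a ∈ F c).card : ℂ)) = 0 := by
        refine Finset.sum_eq_zero fun D₀ hD₀ => ?_
        obtain ⟨hne, hmem⟩ := Finset.mem_erase.mp hD₀
        obtain ⟨hD₀C, hD₀D⟩ := Finset.mem_filter.mp hmem
        have hss : D₀ ⊂ D := lt_of_le_of_ne hD₀D hne
        have hlt := Finset.card_lt_card hss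
        refine Finset.sum_eq_zero fun T' hT' => ?_
        rw [ih D₀ hss hD₀C (by omega) T' hT', zero_mul]
      rw [hrest, add_zero] at h1
      exact h1
    have hzero := translate_eq_zero N N.powerset (fun I hI => Finset.mem_powerset.mp hI)
      (fun I hI A hA => Finset.mem_powerset.mpr (hA.trans (Finset.mem_powerset.mp hI)))
      (fun T => b (D ∪ T)) (fun a => ((D.filter fun c => a ∈ F c).card : ℂ)) hg
    have hinv := translate_inversion N T (Finset.mem_powerset.mp hT) (fun T => b (D ∪ T))
      (fun a => ((D.filter fun c => a ∈ F c).card : ℂ))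
    refine hinv.trans (Finset.sum_eq_zero fun A hA => ?_)
    obtain ⟨hAN, -⟩ := Finset.mem_filter.mp hA
    rw [hzero A hAN, zero_mul]

/-- **STEP B(i) — THE CO-SINGLETON BLOCKS.** For `q ∈ C` and `T ⊆ N`:
`b((C∖q) ⊔ T) = b(univ∖q) · ∏_{a ∈ N∖T} #{c ∈ C∖q : a ∈ F c}`. See the module docstring. -/
theorem eraseBlock_eq (h : ℕ) (C N : Finset (Fin h)) (hN : N = Finset.univ \ C) (F : Fin h → Finset (Fin h))
    (b : Finset (Fin h) → ℂ)
    (hcol : ∀ J : Finset (Fin h), J.card + 2 ≤ h →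
      ∑ S : Finset (Fin h), b S * ((if S ∩ C ⊆ J then 1 else 0) *
        ∏ a ∈ S \ C, ((if a ∈ J then (1 : ℂ) else 0) - (((J ∩ C).filter fun c => a ∈ F c).card : ℂ))) = 0)
    (q : Fin h) (hq : q ∈ C) (T : Finset (Fin h)) (hT : T ⊆ N) :
    b (C.erase q ∪ T) = b (Finset.univ.erase q) * ∏ a ∈ N \ T, (((C.erase q).filter fun c => a ∈ F c).card : ℂ) := by
  have hmemN : ∀ x, x ∈ N ↔ x ∉ C := fun x => by simp [hN]
  have hsn : C.card + N.card = h := by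
    rw [hN, Finset.card_sdiff_of_subset (Finset.subset_univ C), Finset.card_univ, Fintype.card_fin]
    have : C.card ≤ h := by simpa using Finset.card_le_univ C
    omega
  have hD : C.erase q ⊆ C := Finset.erase_subset q C
  have hDcard : (C.erase q).card + 1 = C.card := Finset.card_erase_add_one hq
  -- the evaluations of `g_q : T ↦ b ((C∖q) ⊔ T)` vanish at every `I ⊊ N`
  have hg : ∀ I ∈ N.powerset.erase N, ∑ T ∈ N.powerset,
      (fun T => b (C.erase q ∪ T)) T * ∏ a ∈ T, ((if a ∈ I then (1 : ℂ) else 0)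
        - (fun a => (((C.erase q).filter fun c => a ∈ F c).card : ℂ)) a) = 0 := by
    intro I hI
    obtain ⟨hIne, hIN⟩ := Finset.mem_erase.mp hI
    have hI' : I ⊆ N := Finset.mem_powerset.mp hIN
    have hIcard : I.card < N.card := Finset.card_lt_card (lt_of_le_of_ne hI' hIne)
    have hcard : (C.erase q).card + I.card + 2 ≤ h := by omega
    have h1 := block_column_eq h C N hN F b hcol (C.erase q) I hD hI' hcard
    have hDmem : C.erase q ∈ C.powerset.filter (fun D₀ => D₀ ⊆ C.erase q) :=
      Finset.mem_filter.mpr ⟨Finset.mem_powerset.mpr hD, subset_refl _⟩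
    rw [← Finset.add_sum_erase _ _ hDmem] at h1
    have hrest : ∑ D₀ ∈ (C.powerset.filter (fun D₀ => D₀ ⊆ C.erase q)).erase (C.erase q), ∑ T ∈ N.powerset,
        b (D₀ ∪ T) * ∏ a ∈ T, ((if a ∈ I then (1 : ℂ) else 0)
          - (((C.erase q).filter fun c => a ∈ F c).card : ℂ)) = 0 := by
      refine Finset.sum_eq_zero fun D₀ hD₀ => ?_
      obtain ⟨hne, hmem⟩ := Finset.mem_erase.mp hD₀
      obtain ⟨hD₀C, hD₀D⟩ := Finset.mem_filter.mp hmem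
      have hss : D₀ ⊂ C.erase q := lt_of_le_of_ne hD₀D hne
      have hlt := Finset.card_lt_card hss
      refine Finset.sum_eq_zero fun T' hT' => ?_
      rw [lowerBlocks_zero h C N hN F b hcol D₀ hD₀C (by omega) T' hT', zero_mul]
    rw [hrest, add_zero] at h1
    exact h1
  have hdown : ∀ I ∈ N.powerset.erase N, ∀ A, A ⊆ I → A ∈ N.powerset.erase N := by
    intro I hI A hA
    obtain ⟨hIne, hIN⟩ := Finset.mem_erase.mp hI
    have hI' : I ⊆ N := Finset.mem_powerset.mp hIN
    refine Finset.mem_erase.mpr ⟨?_, Finset.mem_powerset.mpr (hA.trans hI')⟩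
    rintro rfl
    exact hIne (Finset.Subset.antisymm hI' hA)
  have hzero := translate_eq_zero N (N.powerset.erase N) (fun I hI => Finset.mem_powerset.mp (Finset.mem_of_mem_erase hI))
    hdown (fun T => b (C.erase q ∪ T)) (fun a => (((C.erase q).filter fun c => a ∈ F c).card : ℂ)) hg
  have hinv := translate_inversion N T hT (fun T => b (C.erase q ∪ T))
    (fun a => (((C.erase q).filter fun c => a ∈ F c).card : ℂ))
  refine hinv.trans ?_
  -- only `A = N` survives
  have hNmem : N ∈ N.powerset.filter (fun A => T ⊆ A) :=
    Finset.mem_filter.mpr ⟨Finset.mem_powerset.mpr (subset_refl N), hT⟩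
  rw [← Finset.add_sum_erase _ _ hNmem]
  have hrest : ∑ A ∈ (N.powerset.filter (fun A => T ⊆ A)).erase N,
      (∑ T' ∈ N.powerset with A ⊆ T', (fun T => b (C.erase q ∪ T)) T' *
          ∏ a ∈ T' \ A, (-(fun a => (((C.erase q).filter fun c => a ∈ F c).card : ℂ)) a)) *
        ∏ a ∈ A \ T, (fun a => (((C.erase q).filter fun c => a ∈ F c).card : ℂ)) a = 0 := by
    refine Finset.sum_eq_zero fun A hA => ?_
    obtain ⟨hne, hmem⟩ := Finset.mem_erase.mp hA
    obtain ⟨hAN, -⟩ := Finset.mem_filter.mp hmem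
    rw [hzero A (Finset.mem_erase.mpr ⟨hne, hAN⟩), zero_mul]
  rw [hrest, add_zero]
  -- the top translate is `g_q(N) = b(univ ∖ q)`
  have htop : (N.powerset.filter fun T' => N ⊆ T') = {N} := by
    ext T'
    simp only [Finset.mem_filter, Finset.mem_powerset, Finset.mem_singleton]
    constructor
    · rintro ⟨h1, h2⟩; exact Finset.Subset.antisymm h1 h2
    · intro hT'N
      rw [hT'N]
      exact ⟨subset_refl _, subset_refl _⟩
  have hset : C.erase q ∪ N = Finset.univ.erase q := by
    ext x
    simp only [Finset.mem_union, Finset.mem_erase, Finset.mem_univ, and_true, hmemN]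
    constructor
    · rintro (⟨hxq, -⟩ | hxC)
      · exact hxq
      · rintro rfl; exact hxC hq
    · intro hxq
      by_cases hxC : x ∈ C
      · exact Or.inl ⟨hxq, hxC⟩
      · exact Or.inr hxC
  rw [htop, Finset.sum_singleton, Finset.sdiff_self, Finset.prod_empty, mul_one, hset]

end BallDiag

end

end Summit.ValiantsHypothesis.ValiantsHypothesis.Theorems.BarrierLever.HiddenStates
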